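import Summits.PneNP.PneNP.Theorems.OverlapGapAlgebraNoStableSectionGlue2

/-!
# Crux `NoStableSection` (stmt-PneNP-2462), line `DartGame` — glue 3: `k`-asymptotics, the crux
`KACond k` holds for every large `k` (window `[2.6, 2.7]·log k/k`, `η = 1/k²`, `ν = 4^{-k}`,
`θ = 1/(k log² k)`: small ball `≤ 0.39`, slack terms vanish); the six stubs imply
`Summit.PneNP.PneNP.Theses.OverlapGapAlgebra.NoStableSection` BY NAME (`glue_noStableSection`,
`stub_glue : Glue`). Lead prover-line-stmt-PneNP-2462-0. -/

namespace Summit.PneNP.PneNP.Cruxes.NoStableSection.DartGame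

set_option linter.dupNamespace false -- `Summit.PneNP.PneNP.…`: summit = sub-problem (D-0017)

open Finset Real

section KAsymptotics

open Filter Real Finset
open scoped Topology

/-- `h₂(x) ≤ -x log x + x` for `0 < x < 1` (crude entropy bound). -/
theorem glue_binEntropy_le {x : ℝ} (_hx0 : 0 < x) (hx1 : x < 1) :
    binEntropy x ≤ -(x * Real.log x) + x := by
  rw [binEntropy_eq_negMulLog_add_negMulLog_one_sub]
  have h1 : negMulLog x = -(x * Real.log x) := by simp [negMulLog]
  have h2 : negMulLog (1 - x) ≤ x := by
    have hy : 0 < 1 - x := by linarith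
    have hlog : 1 - (1 - x)⁻¹ ≤ Real.log (1 - x) := Real.one_sub_inv_le_log_of_pos hy
    have : negMulLog (1 - x) = -((1 - x) * Real.log (1 - x)) := by
      simp only [negMulLog]; ring
    rw [this]
    have hmul := mul_le_mul_of_nonneg_left hlog hy.le
    rw [mul_sub, mul_one, mul_inv_cancel₀ hy.ne'] at hmul
    linarith
  linarith

/-- `e^{2.5} ≥ 11.9`. -/
theorem glue_exp_two_pt_five : (11.9 : ℝ) ≤ Real.exp 2.5 := by
  have h1 : (2.7182818283 : ℝ) < Real.exp 1 := Real.exp_one_gt_d9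
  have h2 : (1.625 : ℝ) ≤ Real.exp (1 / 2) := by
    have := Real.quadratic_le_exp_of_nonneg (show (0 : ℝ) ≤ 1 / 2 by norm_num)
    norm_num at this ⊢
    linarith
  have he : Real.exp 2.5 = Real.exp 1 * Real.exp 1 * Real.exp (1 / 2) := by
    rw [← Real.exp_add, ← Real.exp_add]; norm_num
  rw [he]
  have h0 : (0 : ℝ) ≤ Real.exp 1 := Real.exp_nonneg 1
  nlinarith [mul_le_mul h1.le h1.le (by norm_num) h0, Real.exp_nonneg (1 / 2 : ℝ)]

/-- `log k ≥ 7` for `k ≥ 1200`. -/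
theorem glue_log_ge_seven {k : ℕ} (hk : 1200 ≤ k) : (7 : ℝ) ≤ Real.log k := by
  have hk' : (1200 : ℝ) ≤ k := by exact_mod_cast hk
  have he : Real.exp 7 ≤ 1200 := by
    have h1 : Real.exp 1 < 2.7182818286 := Real.exp_one_lt_d9
    have h7 : Real.exp 7 = (Real.exp 1) ^ 7 := by rw [← Real.exp_nat_mul]; norm_num
    rw [h7]
    calc (Real.exp 1) ^ 7 ≤ (2.7182818286 : ℝ) ^ 7 :=
          pow_le_pow_left₀ (Real.exp_nonneg 1) h1.le 7
      _ ≤ 1200 := by norm_num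
  rw [Real.le_log_iff_exp_le (by linarith)]
  exact he.trans hk'

/-- `log 4 ≤ 2`. -/
theorem glue_log_four_le : Real.log 4 ≤ 2 := by
  rw [Real.log_le_iff_le_exp (by norm_num)]
  have h1 : (2.7182818283 : ℝ) < Real.exp 1 := Real.exp_one_gt_d9
  have : Real.exp 2 = Real.exp 1 * Real.exp 1 := by rw [← Real.exp_add]; norm_num
  rw [this]
  nlinarith [Real.exp_nonneg (1 : ℝ)]

/-- The window parameter `s = k p₀ ∈ [2.5, 2.6]`. -/
theorem glue_KA_s {lg : ℝ} (hlg7 : 7 ≤ lg) (hL3 : 5 * Real.log lg ≤ 0.05 * lg) :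
    2.5 ≤ (2.6 * lg - 2 * (1 / lg ^ 2)) / (lg + 2 * Real.log lg) ∧
    (2.6 * lg - 2 * (1 / lg ^ 2)) / (lg + 2 * Real.log lg) ≤ 2.6 := by
  have hloglg : 0 ≤ Real.log lg := Real.log_nonneg (by linarith)
  have htpos : 0 < lg + 2 * Real.log lg := by linarith
  have hlg2 : (49 : ℝ) ≤ lg ^ 2 := by nlinarith
  have hθK : 1 / lg ^ 2 ≤ 1 / 49 := div_le_div_of_nonneg_left zero_le_one (by norm_num) hlg2
  have hθ0 : 0 ≤ 1 / lg ^ 2 := by positivity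
  constructor
  · rw [le_div_iff₀ htpos]; nlinarith
  · rw [div_le_iff₀ htpos]; nlinarith

/-- The binomial-extremality small ball at the window: `SB ≤ 0.39`. -/
theorem glue_KA_SB {k : ℕ} {K p₀ : ℝ} (hk1 : 1 ≤ k) (hK : K = k) (hs_le : K * p₀ ≤ 2.6)
    (hs_ge : 2.5 ≤ K * p₀) (hp0 : 0 ≤ p₀) (hp1 : p₀ ≤ 0.01) :
    2 * (1 - p₀) ^ k + K * p₀ * (1 - p₀) ^ (k - 1) ≤ 0.39 := by
  have hp₀lt : p₀ < 1 := by linarith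
  have hpow : (1 - p₀) ^ k ≤ Real.exp (-(K * p₀)) := by
    have := glue_one_sub_pow_le hp0 hp₀lt.le k
    rw [← hK, mul_comm] at this
    exact this
  have hexp : Real.exp (-(K * p₀)) ≤ Real.exp (-2.5) := Real.exp_le_exp.2 (by linarith)
  have he25 : Real.exp (-2.5) ≤ 1 / 11.9 := by
    rw [Real.exp_neg, one_div]
    exact inv_anti₀ (by norm_num) glue_exp_two_pt_five
  have hq : (1 - p₀) ^ k = (1 - p₀) ^ (k - 1) * (1 - p₀) := by
    rw [← pow_succ, Nat.sub_add_cancel hk1]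
  have h1p : 0 < 1 - p₀ := by linarith
  have hpow1 : (1 - p₀) ^ (k - 1) ≤ Real.exp (-2.5) / (1 - p₀) := by
    rw [le_div_iff₀ h1p, ← hq]; exact hpow.trans hexp
  have hpow1' : (1 - p₀) ^ (k - 1) ≤ (1 / 11.9) / 0.99 := by
    refine hpow1.trans ?_
    calc Real.exp (-2.5) / (1 - p₀) ≤ (1 / 11.9) / (1 - p₀) :=
          div_le_div_of_nonneg_right he25 h1p.le
      _ ≤ (1 / 11.9) / 0.99 := div_le_div_of_nonneg_left (by norm_num) (by norm_num) (by linarith)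
  have hA : 2 * (1 - p₀) ^ k ≤ 2 * (1 / 11.9) := by linarith [hpow.trans (hexp.trans he25)]
  have hB : K * p₀ * (1 - p₀) ^ (k - 1) ≤ 2.6 * ((1 / 11.9) / 0.99) :=
    mul_le_mul hs_le hpow1' (pow_nonneg h1p.le _) (by norm_num)
  have : 2 * (1 / 11.9 : ℝ) + 2.6 * ((1 / 11.9) / 0.99) ≤ 0.39 := by norm_num
  linarith

/-- Entropy of the validity slack: `h₂(c ν) ≤ c ν (k log 4 + 1)`, `ν = 4^{-k}`, `1 ≤ c`, `c ν < 1`. -/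
theorem glue_KA_binEnt {k : ℕ} {K c : ℝ} (hK : K = k) (hc : 1 ≤ c) (hcν : c * (1 / 4 : ℝ) ^ k < 1) :
    binEntropy (c * (1 / 4 : ℝ) ^ k) ≤ c * (1 / 4 : ℝ) ^ k * (K * Real.log 4 + 1) := by
  have hν0 : (0 : ℝ) < (1 / 4 : ℝ) ^ k := by positivity
  have hw0 : 0 < c * (1 / 4 : ℝ) ^ k := by positivity
  have h := glue_binEntropy_le hw0 hcν
  have hlog : Real.log (c * (1 / 4 : ℝ) ^ k) = Real.log c - K * Real.log 4 := by
    rw [Real.log_mul (by positivity) hν0.ne', Real.log_pow, one_div, Real.log_inv, hK]; ring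
  have hlogc : 0 ≤ Real.log c := Real.log_nonneg hc
  rw [hlog] at h
  have e : -(c * (1 / 4 : ℝ) ^ k * (Real.log c - K * Real.log 4)) + c * (1 / 4 : ℝ) ^ k =
      c * (1 / 4 : ℝ) ^ k * (K * Real.log 4 + 1) - c * (1 / 4 : ℝ) ^ k * Real.log c := by ring
  rw [e] at h
  linarith [mul_nonneg hw0.le hlogc]

/-- The `α H(c ν)` terms are small: `α h₂(c ν) ≤ 10 lg K³/2^k` (`α = 5·2^k lg/K`, `c ≤ 2K`). -/
theorem glue_KA_alphaH {k : ℕ} {K lg c : ℝ} (hK : K = k) (hK3 : 3 ≤ K) (hlg0 : 0 ≤ lg)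
    (hc : 1 ≤ c) (hcK : c ≤ 2 * K) (hcν : c * (1 / 4 : ℝ) ^ k < 1) :
    (5 * 2 ^ k * lg / K) * binEntropy (c * (1 / 4 : ℝ) ^ k) ≤ 10 * lg * (K ^ 3 / 2 ^ k) := by
  have hK0 : 0 < K := by linarith
  have h2k : (0 : ℝ) < (2 : ℝ) ^ k := by positivity
  have h14 : (2 : ℝ) ^ k * (1 / 4 : ℝ) ^ k = 1 / 2 ^ k := by
    rw [← mul_pow]; norm_num [div_pow]
  have hl4 : K * Real.log 4 + 1 ≤ K ^ 2 := by
    have := glue_log_four_le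
    have hl40 : 0 ≤ Real.log 4 := Real.log_nonneg (by norm_num)
    nlinarith
  have hH := glue_KA_binEnt hK hc hcν
  calc (5 * 2 ^ k * lg / K) * binEntropy (c * (1 / 4 : ℝ) ^ k)
      ≤ (5 * 2 ^ k * lg / K) * (c * (1 / 4 : ℝ) ^ k * (K * Real.log 4 + 1)) :=
        mul_le_mul_of_nonneg_left hH (by positivity)
    _ = 5 * lg * (c / K) * ((2 : ℝ) ^ k * (1 / 4 : ℝ) ^ k) * (K * Real.log 4 + 1) := by
        field_simp
    _ = 5 * lg * (c / K) * ((K * Real.log 4 + 1) / 2 ^ k) := by rw [h14]; ring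
    _ ≤ 5 * lg * 2 * (K ^ 2 / 2 ^ k) := by
        have h1 : (K * Real.log 4 + 1) / (2 : ℝ) ^ k ≤ K ^ 2 / 2 ^ k :=
          div_le_div_of_nonneg_right hl4 h2k.le
        have h2 : c / K ≤ 2 := by rw [div_le_iff₀ hK0]; linarith
        have h0 : 0 ≤ (K * Real.log 4 + 1) / (2 : ℝ) ^ k := by
          have : 0 ≤ Real.log 4 := Real.log_nonneg (by norm_num)
          positivity
        have h3 : 0 ≤ c / K := by positivity
        calc 5 * lg * (c / K) * ((K * Real.log 4 + 1) / 2 ^ k)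
            ≤ 5 * lg * 2 * ((K * Real.log 4 + 1) / 2 ^ k) :=
              mul_le_mul_of_nonneg_right (mul_le_mul_of_nonneg_left h2 (by positivity)) h0
          _ ≤ 5 * lg * 2 * (K ^ 2 / 2 ^ k) := mul_le_mul_of_nonneg_left h1 (by positivity)
    _ ≤ 5 * lg * 2 * (K ^ 3 / 2 ^ k) := by
        refine mul_le_mul_of_nonneg_left (div_le_div_of_nonneg_right ?_ h2k.le) (by positivity)
        nlinarith
    _ = 10 * lg * (K ^ 3 / 2 ^ k) := by ring

/-- **The `k`-asymptotics**: all parameter conditions hold for every large `k`. -/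
theorem glue_KA : ∀ᶠ k : ℕ in atTop, KACond k := by
  -- standard limits
  have L1 : Tendsto (fun k : ℕ => Real.log k / k) atTop (𝓝 0) := by
    have h := Real.tendsto_pow_log_div_mul_add_atTop 1 0 1 one_ne_zero
    have h' : Tendsto (fun x : ℝ => Real.log x / x) atTop (𝓝 0) := by
      simpa using h
    exact h'.comp tendsto_natCast_atTop_atTop
  have L2 : Tendsto (fun k : ℕ => (k : ℝ) ^ 4 / 2 ^ k) atTop (𝓝 0) :=
    tendsto_pow_const_div_const_pow_of_one_lt 4 one_lt_two
  have L3 : ∀ᶠ k : ℕ in atTop, 5 * Real.log (Real.log k) ≤ 0.05 * Real.log k := by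
    have hlo : ∀ᶠ x : ℝ in atTop, ‖Real.log x‖ ≤ 0.01 * ‖x‖ :=
      Real.isLittleO_log_id_atTop.bound (by norm_num)
    have ht : Tendsto (fun k : ℕ => Real.log k) atTop atTop :=
      Real.tendsto_log_atTop.comp tendsto_natCast_atTop_atTop
    have := ht.eventually hlo
    filter_upwards [this, eventually_ge_atTop 3] with k hk hk3
    have hk3' : (3 : ℝ) ≤ k := by exact_mod_cast hk3
    have hlogpos : 0 < Real.log k := Real.log_pos (by linarith)
    simp only [Real.norm_eq_abs, abs_of_pos hlogpos] at hk
    have := (le_abs_self _).trans hk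
    linarith
  have E1 := eventually_ge_atTop 1200
  have E2 : ∀ᶠ k : ℕ in atTop, (k : ℝ) ^ 4 / 2 ^ k ≤ 0.001 :=
    (L2.eventually (ge_mem_nhds (by norm_num : (0 : ℝ) < 0.001)))
  have E3 : ∀ᶠ k : ℕ in atTop, Real.log k / k ≤ 0.01 :=
    (L1.eventually (ge_mem_nhds (by norm_num : (0 : ℝ) < 0.01)))
  filter_upwards [E1, E2, E3, L3] with k hk hE4 hE3 hL3
  unfold KACond
  have hkr : (1200 : ℝ) ≤ k := by exact_mod_cast hk
  have hk1 : 1 ≤ k := by omega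
  have hlg7' : 7 ≤ Real.log k := glue_log_ge_seven hk
  refine ⟨by omega, ?_⟩
  -- make `K = ↑k` and `lg = log K` opaque
  set K : ℝ := (k : ℝ) with hK
  clear_value K
  have hK0 : (0 : ℝ) < K := by linarith only [hkr]
  have hK3 : (3 : ℝ) ≤ K := by linarith only [hkr]
  have hlgK' : Real.log K ≤ K - 1 := Real.log_le_sub_one_of_pos hK0
  have ht' : -Real.log (1 / (K * (Real.log K) ^ 2)) = Real.log K + 2 * Real.log (Real.log K) := by
    have hlgpos : 0 < Real.log K := by linarith only [hlg7']
    rw [one_div, Real.log_inv, neg_neg, Real.log_mul hK0.ne' (by positivity), Real.log_pow]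
    push_cast; ring
  set lg : ℝ := Real.log K with hlg
  clear_value lg
  have hlg0 : 0 < lg := by linarith only [hlg7']
  have hlgK : lg ≤ K := by linarith only [hlgK']
  have h2k : (0 : ℝ) < (2 : ℝ) ^ k := by positivity
  -- the small quantities
  have hE2 : K ^ 3 / 2 ^ k ≤ 0.001 :=
    le_trans (div_le_div_of_nonneg_right
      (pow_le_pow_right₀ (by linarith only [hkr]) (by norm_num : 3 ≤ 4)) h2k.le) hE4
  have hK3' : (1 : ℝ) ≤ K ^ 3 := one_le_pow₀ (by linarith only [hkr])
  have hinv2 : 1 / (2 : ℝ) ^ k ≤ 0.001 :=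
    (div_le_div_of_nonneg_right hK3' h2k.le).trans hE2
  have hK2small : K ^ 2 / 2 ^ k ≤ 0.001 := by
    refine le_trans (div_le_div_of_nonneg_right ?_ h2k.le) hE2
    nlinarith only [hkr]
  have hν : (1 / 4 : ℝ) ^ k ≤ 1 / 2 ^ k := by
    rw [div_pow, one_pow]
    exact div_le_div_of_nonneg_left zero_le_one h2k (pow_le_pow_left₀ (by norm_num) (by norm_num) k)
  have hν0 : (0 : ℝ) < (1 / 4 : ℝ) ^ k := by positivity
  have hνsmall : (1 / 4 : ℝ) ^ k ≤ 0.001 := hν.trans hinv2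
  have hw : (K + 1) * (1 / 4 : ℝ) ^ k ≤ 0.001 := by
    calc (K + 1) * (1 / 4 : ℝ) ^ k ≤ (K + 1) * (1 / 2 ^ k) :=
          mul_le_mul_of_nonneg_left hν (by linarith only [hkr])
      _ ≤ K ^ 2 * (1 / 2 ^ k) := mul_le_mul_of_nonneg_right (by nlinarith only [hkr]) (by positivity)
      _ = K ^ 2 / 2 ^ k := by ring
      _ ≤ 0.001 := hK2small
  -- `θ`
  have hKlg : 0 < K * lg ^ 2 := by positivity
  have hloglg : 0 ≤ Real.log lg := Real.log_nonneg (by linarith only [hlg7'])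
  have htpos : 0 < lg + 2 * Real.log lg := by linarith only [hlg0, hloglg]
  have hθlt : 1 / (K * lg ^ 2) < 1 := by
    rw [div_lt_one hKlg]; nlinarith only [hkr, hlg7']
  have hlg2 : (49 : ℝ) ≤ lg ^ 2 := by nlinarith only [hlg7']
  have hθK : 1 / lg ^ 2 ≤ 1 / 49 := div_le_div_of_nonneg_left zero_le_one (by norm_num) hlg2
  -- `s = K p₀ ∈ [2.5, 2.6]`, `p₀ ∈ [0, 0.01]`
  set p₀ : ℝ := (2.6 * (lg / K) - 2 * (1 / (K * lg ^ 2))) / (-Real.log (1 / (K * lg ^ 2))) with hp₀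
  clear_value p₀
  have hs : K * p₀ = (2.6 * lg - 2 * (1 / lg ^ 2)) / (lg + 2 * Real.log lg) := by
    rw [hp₀, ht']
    field_simp
  obtain ⟨hs_ge, hs_le⟩ : 2.5 ≤ K * p₀ ∧ K * p₀ ≤ 2.6 := by
    rw [hs]; exact glue_KA_s hlg7' hL3
  have hp₀0 : 0 ≤ p₀ := by
    by_contra h
    have : K * p₀ < 0 := mul_neg_of_pos_of_neg hK0 (lt_of_not_ge h)
    linarith only [this, hs_ge]
  have hp₀1 : p₀ ≤ 0.01 := by
    by_contra h
    have h' : 0.01 < p₀ := lt_of_not_ge h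
    have : K * 0.01 < K * p₀ := mul_lt_mul_of_pos_left h' hK0
    linarith only [this, hs_le, hkr]
  -- the small ball and `D`
  have hSB := glue_KA_SB hk1 hK hs_le hs_ge hp₀0 hp₀1
  set D : ℝ := (1 : ℝ) + K * (1 - (2 * (1 - p₀) ^ k + K * p₀ * (1 - p₀) ^ (k - 1))) -
    (1 / (K * lg ^ 2)) * (K * (K + 1) / 2) with hD
  clear_value D
  have hDge : 0.599 * K ≤ D := by
    have h1 : K * 0.61 ≤ K * (1 - (2 * (1 - p₀) ^ k + K * p₀ * (1 - p₀) ^ (k - 1))) :=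
      mul_le_mul_of_nonneg_left (by linarith only [hSB]) hK0.le
    have h2 : (1 / (K * lg ^ 2)) * (K * (K + 1) / 2) = (K + 1) / 2 * (1 / lg ^ 2) := by
      field_simp
    have h3 : (1 / (K * lg ^ 2)) * (K * (K + 1) / 2) ≤ (K + 1) / 2 * (1 / 49) := by
      rw [h2]; exact mul_le_mul_of_nonneg_left hθK (by linarith only [hkr])
    rw [hD]; linarith only [h1, h3, hkr]
  have hD0 : 0 ≤ D := by nlinarith only [hDge, hkr]
  -- `α H(ν) ≤ 10 lg K³/2^k`, `α H(w) ≤ 20 K lg K³/2^k`-type bounds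
  have hαHν : (5 * 2 ^ k * lg / K) * binEntropy ((1 / 4 : ℝ) ^ k) ≤ 0.01 * (lg / K) := by
    have hH := glue_KA_binEnt (c := 1) hK le_rfl (by rw [one_mul]; linarith only [hνsmall])
    have h14 : (2 : ℝ) ^ k * (1 / 4 : ℝ) ^ k = 1 / 2 ^ k := by
      rw [← mul_pow]; norm_num [div_pow]
    have hl4 : K * Real.log 4 + 1 ≤ K ^ 2 := by
      have := glue_log_four_le
      have hl40 : 0 ≤ Real.log 4 := Real.log_nonneg (by norm_num)
      nlinarith only [this, hl40, hkr]
    rw [one_mul] at hH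
    calc (5 * 2 ^ k * lg / K) * binEntropy ((1 / 4 : ℝ) ^ k)
        ≤ (5 * 2 ^ k * lg / K) * ((1 / 4 : ℝ) ^ k * (K * Real.log 4 + 1)) :=
          mul_le_mul_of_nonneg_left hH (by positivity)
      _ = 5 * (lg / K) * ((2 : ℝ) ^ k * (1 / 4 : ℝ) ^ k) * (K * Real.log 4 + 1) := by ring
      _ = 5 * (lg / K) * ((K * Real.log 4 + 1) / 2 ^ k) := by rw [h14]; ring
      _ ≤ 5 * (lg / K) * (K ^ 2 / 2 ^ k) :=
          mul_le_mul_of_nonneg_left (div_le_div_of_nonneg_right hl4 h2k.le) (by positivity)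
      _ ≤ 5 * (lg / K) * 0.001 := mul_le_mul_of_nonneg_left hK2small (by positivity)
      _ ≤ 0.01 * (lg / K) := by
          have : 0 ≤ lg / K := by positivity
          linarith only [this]
  have hαHw : (5 * 2 ^ k * lg / K) * binEntropy ((K + 1) * (1 / 4 : ℝ) ^ k) ≤ 0.05 := by
    have h := glue_KA_alphaH (c := K + 1) hK hK3 hlg0.le (by linarith only [hkr])
      (by linarith only [hkr]) (by linarith only [hw])
    have h' : 10 * lg * (K ^ 3 / 2 ^ k) ≤ 10 * K * (K ^ 3 / 2 ^ k) :=
      mul_le_mul_of_nonneg_right (by linarith only [hlgK]) (by positivity)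
    have h'' : 10 * K * (K ^ 3 / 2 ^ k) = 10 * (K ^ 4 / 2 ^ k) := by ring
    linarith only [h, h', h'', hE4]
  -- (c3)
  have hc3 : binEntropy (1 / K ^ 2) ≤ 2.7 * (lg / K) - 2.6 * (lg / K) := by
    have hx0 : (0 : ℝ) < 1 / K ^ 2 := by positivity
    have hx1 : 1 / K ^ 2 < 1 := by
      rw [div_lt_one (by positivity)]; nlinarith only [hkr]
    have h := glue_binEntropy_le hx0 hx1
    have hlogx : Real.log (1 / K ^ 2) = -(2 * lg) := by
      rw [one_div, Real.log_inv, Real.log_pow, hlg]; ring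
    rw [hlogx] at h
    have hkey : 1 / K ^ 2 * (2 * lg) + 1 / K ^ 2 ≤ 0.1 * (lg / K) := by
      rw [show 1 / K ^ 2 * (2 * lg) + 1 / K ^ 2 = (2 * (lg / K) + 1 / K) * (1 / K) by
        field_simp]
      rw [show 0.1 * (lg / K) = (0.1 * lg) * (1 / K) by ring]
      refine mul_le_mul_of_nonneg_right ?_ (by positivity)
      have : 1 / K ≤ 1 / 1200 := div_le_div_of_nonneg_left zero_le_one (by norm_num) hkr
      linarith only [this, hE3, hlg7']
    have e : -(1 / K ^ 2 * -(2 * lg)) + 1 / K ^ 2 = 1 / K ^ 2 * (2 * lg) + 1 / K ^ 2 := by ring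
    rw [e] at h
    linarith only [h, hkey]
  have hlgK0 : 0 < lg / K := div_pos hlg0 hK0
  -- assemble
  refine ⟨?_, hc3, by linarith only [hw], hθlt, ?_, hD0, ?_, ?_⟩
  · -- `1/K² ≤ 1/2`
    rw [div_le_div_iff₀ (by positivity) (by norm_num)]; nlinarith only [hkr]
  · -- `2θ ≤ 2.6 lg/K`
    rw [show 2 * (1 / (K * lg ^ 2)) = (2 / lg ^ 2) * (1 / K) by field_simp,
      show 2.6 * (lg / K) = (2.6 * lg) * (1 / K) by ring]
    refine mul_le_mul_of_nonneg_right ?_ (by positivity)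
    rw [div_le_iff₀ (by positivity)]; nlinarith only [hlg7']
  · -- (c8) the `S_indep` exponent
    have hhalf : (1 / 2 : ℝ) ^ k * (1 - (1 / 4 : ℝ) ^ k) * (5 * 2 ^ k * lg / K) =
        5 * (lg / K) * (1 - (1 / 4 : ℝ) ^ k) := by
      have : (1 / 2 : ℝ) ^ k * (2 : ℝ) ^ k = 1 := by rw [← mul_pow]; norm_num
      calc (1 / 2 : ℝ) ^ k * (1 - (1 / 4 : ℝ) ^ k) * (5 * 2 ^ k * lg / K)
          = ((1 / 2 : ℝ) ^ k * (2 : ℝ) ^ k) * (5 * (lg / K) * (1 - (1 / 4 : ℝ) ^ k)) := by ring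
        _ = 5 * (lg / K) * (1 - (1 / 4 : ℝ) ^ k) := by rw [this, one_mul]
    rw [hhalf]
    have hx := mul_le_mul_of_nonneg_left hνsmall hlgK0.le
    linarith only [hαHν, hx, hlgK0]
  · -- (c9) the `S_ogp` exponent
    have hhalf : (1 / 2 : ℝ) ^ k * (5 * 2 ^ k * lg / K) = 5 * (lg / K) := by
      have : (1 / 2 : ℝ) ^ k * (2 : ℝ) ^ k = 1 := by rw [← mul_pow]; norm_num
      calc (1 / 2 : ℝ) ^ k * (5 * 2 ^ k * lg / K)
          = ((1 / 2 : ℝ) ^ k * (2 : ℝ) ^ k) * (5 * (lg / K)) := by ring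
        _ = 5 * (lg / K) := by rw [this, one_mul]
    rw [hhalf]
    have hlog2 : Real.log 2 < 0.6931471808 := Real.log_two_lt_d9
    have hmainterm : 2.965 * lg ≤ 5 * (lg / K) * D * (1 - (K + 1) * (1 / 4 : ℝ) ^ k) := by
      have hw' : 0.99 ≤ 1 - (K + 1) * (1 / 4 : ℝ) ^ k := by linarith only [hw]
      have h1 : 5 * (lg / K) * (0.599 * K) * 0.99 ≤
          5 * (lg / K) * D * (1 - (K + 1) * (1 / 4 : ℝ) ^ k) :=
        mul_le_mul (mul_le_mul_of_nonneg_left hDge (by positivity)) hw' (by norm_num)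
          (by positivity)
      have h2 : 5 * (lg / K) * (0.599 * K) * 0.99 = 2.96505 * lg := by field_simp; ring
      linarith only [h1, h2, hlg0]
    have e : K * (2.7 * (lg / K)) = 2.7 * lg := by field_simp
    rw [e]
    have hx : 2 * (lg / K) ≤ 0.02 := by linarith only [hE3]
    linarith only [hmainterm, hαHw, hlog2, hx, hlg7']

end KAsymptotics
section Assembly

open Filter Real Finset
open scoped Classical Topology

/-- **The glue**: the six stubs imply the crux. -/
theorem glue_noStableSection (hA : LadderExtraction) (hB : EntropyToolkit) (hC : CondEntCount)
    (hE : PathValidCount) (hF : IndepCount) (hEn : EnergyBound) :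
    Summit.PneNP.PneNP.Theses.OverlapGapAlgebra.NoStableSection := by
  obtain ⟨k₀, hk₀⟩ := Filter.eventually_atTop.1 glue_KA
  refine ⟨k₀, fun k hk => ?_⟩
  obtain ⟨h2k, hη2, hwin, hνk, hθ1, hθb, hD0, hI, hO⟩ := hk₀ k hk
  have hkr : (2 : ℝ) ≤ k := by exact_mod_cast h2k
  have hkpos : (0 : ℝ) < k := by linarith
  have hlogk : 0 < Real.log k := Real.log_pos (by linarith)
  have hLr : 0 < Real.log k / k := div_pos hlogk hkpos
  have hη0 : (0 : ℝ) < 1 / (k : ℝ) ^ 2 := by positivity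
  have hν0 : (0 : ℝ) < (1 / 4 : ℝ) ^ k := by positivity
  have hθ0 : (0 : ℝ) < 1 / ((k : ℝ) * (Real.log k) ^ 2) := by positivity
  have hbm : (0 : ℝ) < 2.6 * (Real.log k / k) := by positivity
  have hα : (0 : ℝ) < 5 * 2 ^ k * Real.log k / k := by positivity
  refine ⟨1 / (k : ℝ) ^ 2, hη0, (1 / 4 : ℝ) ^ k, hν0, Real.log k / k / 2, half_pos hLr, ?_⟩
  have hmain := glue_fixed_k (k := k) hA hB hC hE hF hEn h2k hη0 hη2 hν0 hνk hbm hwin hθ0 hθ1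
    hθb hLr hα hD0 hI hO
  filter_upwards [hmain] with n hn m hm g
  convert hn m hm g using 3
  ext Ψ
  simp only [Finset.mem_filter, Finset.mem_univ, true_and]
  exact Iff.rfl

end Assembly

/-- **Stub `stub_glue`** (registered on stmt-PneNP-2462): the six worker stubs imply the crux. -/
theorem stub_glue : Glue :=
  fun hA hB hC hE hF hEn => glue_noStableSection hA hB hC hE hF hEn

end Summit.PneNP.PneNP.Cruxes.NoStableSection.DartGame
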